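import Summits.PneNP.PneNP.Theorems.CodingVolumeShiftsCodingVolumeLinearSums

/-!
# Route CodingVolumeShifts — crux `CodingVolume` (stmt-PneNP-19454): the cell `C = 4` for LINEAR
# one-shot codes

Final part of the `C = 4` rung for `𝔽₂`-LINEAR (more generally: `K`-linear, any field) one-shot
codes: a k-pairs network all of whose pairs are at undirected distance `≥ 4` and which carries a
linear one-shot code has at least `4k` arcs — the routing volume, for EVERY degree bound, with the
optimal `L = 4` (`CodingVolume.Negative.codingVolume_ceiling`). This is the first cell of the ladder
X = `CodingVolume` in the open region `Δ ≥ 2, C ≥ 4`, for the linear class (which contains all XOR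
networks and all linear network codes over `GF(2)`; the crux itself quantifies over arbitrary
Boolean codes).

* `codingVolume_linear_level` — the per-level inequality
  `Σ_v finrank (f_{r+1} IS_v) + 4·|A_r| ≤ Σ_v finrank (f_r IS_v) + Σ_{i ∈ A_r} |In(sink i)|`;
* `codingVolume_linear_potential` — telescoping over the levels:
  `4k ≤ Σ_{v middle} finrank (IS v) + Σ_i |In(sink i)|`;
* `codingVolume_four_mul_card_le_arcCount_of_labels` (any field),
  `codingVolume_four_mul_card_le_arcCount_of_linear` (Boolean codes with additive arc bits) and the
  crux-shaped `codingVolume_rung_four_linear`: `∀ Δ, ∃ L (= 4), …, 4·k ≤ m` for linear codes.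

No definitions.
-/

set_option linter.dupNamespace false -- `Summit.PneNP.PneNP.…`: summit = sub-problem name (D-0017)

namespace Summit.PneNP.PneNP.Theorems

open Literature.InformationTheory.NetworkCoding Module Submodule Finset

section Four

variable {K : Type*} [Field K] {ι : Type} [Fintype ι] [DecidableEq ι] {N : KPairsNet ι}
  {φ : N.A → Module.Dual K (ι → K)}

/-- **PER-LEVEL INEQUALITY.** With `f` killing the coordinates of level `< r` and `f'` those of
level `< r + 1`:
`Σ_{v middle} finrank (f' (IS v)) + 4·|A_r| ≤ Σ_{v middle} finrank (f (IS v)) + Σ_{i ∈ A_r} |In(sink i)|`.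
[folklore] -/
theorem codingVolume_linear_level
    (hloc : ∀ b, φ b ∈ span K (φ '' ↑(N.inArcs (N.src b)) ∪
      (fun i => (LinearMap.proj i : Module.Dual K (ι → K))) '' {i | N.source i = N.src b}))
    (hdec : ∀ i, (LinearMap.proj i : Module.Dual K (ι → K)) ∈
      span K (φ '' ↑(N.inArcs (N.sink i))))
    (hfar : N.Far 4) (hr : ι → ℕ)
    (hrA : ∀ i, ∃ a, N.src a = N.source i ∧ (∀ l, N.tgt a ≠ N.sink l) ∧ φ a ≠ 0 ∧
      N.rank (N.tgt a) = hr i)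
    (hhr : ∀ i a, N.src a = N.source i → (∀ l, N.tgt a ≠ N.sink l) → φ a ≠ 0 →
      hr i ≤ N.rank (N.tgt a))
    (r : ℕ) {f f' : Module.Dual K (ι → K) →ₗ[K] Module.Dual K (ι → K)}
    (hf : ∀ i, f (LinearMap.proj i) = if i ∈ {j | hr j < r} then 0 else LinearMap.proj i)
    (hf' : ∀ i, f' (LinearMap.proj i) = if i ∈ {j | hr j < r + 1} then 0 else LinearMap.proj i) :
    (∑ v ∈ univ.filter (fun v : N.V => (∀ j, v ≠ N.source j) ∧ ∀ j, v ≠ N.sink j),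
        finrank K ((span K (φ '' ↑(N.inArcs v))).map f')) +
      4 * (univ.filter fun i => hr i = r).card ≤
    (∑ v ∈ univ.filter (fun v : N.V => (∀ j, v ≠ N.source j) ∧ ∀ j, v ≠ N.sink j),
        finrank K ((span K (φ '' ↑(N.inArcs v))).map f)) +
      ∑ i ∈ univ.filter (fun i => hr i = r), (N.inArcs (N.sink i)).card := by
  classical
  set A := univ.filter (fun i => hr i = r) with hA
  set Mset := univ.filter (fun v : N.V => (∀ j, v ≠ N.source j) ∧ ∀ j, v ≠ N.sink j) with hM
  set A1 := A.filter (fun j => ∀ a a', N.src a = N.source j → N.src a' = N.source j →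
      (∀ l, N.tgt a ≠ N.sink l) → (∀ l, N.tgt a' ≠ N.sink l) → φ a ≠ 0 → φ a' ≠ 0 →
      N.tgt a = N.tgt a') with hA1def
  have hA1 : ∀ j, j ∈ A1 ↔ hr j = r ∧ ∀ a a', N.src a = N.source j → N.src a' = N.source j →
      (∀ l, N.tgt a ≠ N.sink l) → (∀ l, N.tgt a' ≠ N.sink l) → φ a ≠ 0 → φ a' ≠ 0 →
      N.tgt a = N.tgt a' := by
    intro j; rw [hA1def, Finset.mem_filter, hA, Finset.mem_filter]; simp
  obtain ⟨g, hg⟩ := codingVolume_exists_kill (K := K) {j | j ∉ A1}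
  -- the three global counts
  have hT := codingVolume_linear_sum_T (φ := φ) hr hrA r A1 hA1
  have hSU := codingVolume_linear_sum_SU hloc hdec hfar hr hrA hhr r hf A1 hA1 hg
  have hS := codingVolume_linear_sinks hloc hdec hfar hr r
  rw [← hA, ← hM] at hT hS
  rw [← hM] at hSU
  -- per-vertex credits, summed
  have hV : ∀ v ∈ Mset,
      finrank K ((span K (φ '' ↑(N.inArcs v))).map f') +
        (A.filter (fun i => ∃ a, N.src a = N.source i ∧ N.tgt a = v ∧ φ a ≠ 0)).card +
        finrank K (((span K (φ '' {b | N.tgt b = v ∧ (∀ j, N.src b ≠ N.source j) ∧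
          N.rank (N.src b) = r})).map f).map g) +
        (A.filter (fun i => (N.inArcs (N.sink i)).card ≤ 1 ∧
          ∃ b ∈ N.inArcs (N.sink i), N.src b = v)).card ≤
      finrank K ((span K (φ '' ↑(N.inArcs v))).map f) := by
    intro v hv
    rw [hM, Finset.mem_filter] at hv
    refine codingVolume_linear_vertex hloc hdec hfar hr hrA hhr r hf hf' A1 hA1 hg v hv.2.2
      _ (fun i => ?_) _ (fun i => ?_)
    · rw [Finset.mem_filter, hA, Finset.mem_filter]; simp
    · rw [Finset.mem_filter, hA, Finset.mem_filter]; simp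
  have hsum := Finset.sum_le_sum hV
  simp only [Finset.sum_add_distrib] at hsum
  -- `|A1| + |A \ A1| = |A|`
  have hsub : A1 ⊆ A := Finset.filter_subset _ _
  have hsplit : A1.card + (A.filter (· ∉ A1)).card = A.card := by
    have h := Finset.card_filter_add_card_filter_not (s := A) (p := fun j => j ∈ A1)
    rw [Finset.filter_mem_eq_inter, Finset.inter_eq_right.mpr hsub] at h
    exact h
  omega

/-- **THE POTENTIAL BOUND.** For a `4`-far k-pairs network with a labelling satisfying
LOCALITY/DECODABILITY: `4k ≤ Σ_{v middle} finrank (IS v) + Σ_i |In(sink i)|` (telescoping the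
per-level inequalities along the coordinate-killing filtration). [folklore] -/
theorem codingVolume_linear_potential
    (hloc : ∀ b, φ b ∈ span K (φ '' ↑(N.inArcs (N.src b)) ∪
      (fun i => (LinearMap.proj i : Module.Dual K (ι → K))) '' {i | N.source i = N.src b}))
    (hdec : ∀ i, (LinearMap.proj i : Module.Dual K (ι → K)) ∈
      span K (φ '' ↑(N.inArcs (N.sink i))))
    (hfar : N.Far 4) :
    4 * Fintype.card ι ≤
      (∑ v ∈ univ.filter (fun v : N.V => (∀ j, v ≠ N.source j) ∧ ∀ j, v ≠ N.sink j),
        finrank K (span K (φ '' ↑(N.inArcs v)))) + ∑ i, (N.inArcs (N.sink i)).card := by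
  classical
  set Mset := univ.filter (fun v : N.V => (∀ j, v ≠ N.source j) ∧ ∀ j, v ≠ N.sink j) with hM
  -- the levels
  have hfar2 : ∀ i, (2 : ℕ∞) ≤ N.graph.edist (N.source i) (N.sink i) := fun i =>
    le_trans (by exact_mod_cast (by norm_num : (2 : ℕ) ≤ 4)) (hfar i)
  let Rk : ι → Finset ℕ := fun i => (univ.filter (fun a => N.src a = N.source i ∧
    (∀ l, N.tgt a ≠ N.sink l) ∧ φ a ≠ 0)).image (fun a => N.rank (N.tgt a))
  have hRk : ∀ i, (Rk i).Nonempty := by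
    intro i
    obtain ⟨a, ha, hM, hz⟩ := codingVolume_exists_effective_arc hloc hdec i (hfar2 i)
    exact ⟨_, Finset.mem_image_of_mem _ (by rw [Finset.mem_filter]; exact ⟨Finset.mem_univ _, ha, hM, hz⟩)⟩
  let hr : ι → ℕ := fun i => (Rk i).min' (hRk i)
  have hrA : ∀ i, ∃ a, N.src a = N.source i ∧ (∀ l, N.tgt a ≠ N.sink l) ∧ φ a ≠ 0 ∧
      N.rank (N.tgt a) = hr i := by
    intro i
    have hmem := Finset.min'_mem (Rk i) (hRk i)
    obtain ⟨a, ha, hrk⟩ := Finset.mem_image.mp hmem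
    rw [Finset.mem_filter] at ha
    exact ⟨a, ha.2.1, ha.2.2.1, ha.2.2.2, hrk⟩
  have hhr : ∀ i a, N.src a = N.source i → (∀ l, N.tgt a ≠ N.sink l) → φ a ≠ 0 →
      hr i ≤ N.rank (N.tgt a) := by
    intro i a ha hM hz
    refine Finset.min'_le (Rk i) _ (Finset.mem_image_of_mem _ ?_)
    rw [Finset.mem_filter]; exact ⟨Finset.mem_univ _, ha, hM, hz⟩
  -- telescoping along `R`
  have step : ∀ R : ℕ, ∀ f : Module.Dual K (ι → K) →ₗ[K] Module.Dual K (ι → K),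
      (∀ i, f (LinearMap.proj i) = if i ∈ {j | hr j < R} then 0 else LinearMap.proj i) →
      (∑ v ∈ Mset, finrank K ((span K (φ '' ↑(N.inArcs v))).map f)) +
        4 * (univ.filter fun i => hr i < R).card ≤
      (∑ v ∈ Mset, finrank K (span K (φ '' ↑(N.inArcs v)))) +
        ∑ i ∈ univ.filter (fun i => hr i < R), (N.inArcs (N.sink i)).card := by
    intro R
    induction R with
    | zero =>
      intro f hf
      have hfid : f = LinearMap.id :=
        codingVolume_dual_hom_ext fun i => by rw [hf i, if_neg (by simp)]; rfl
      have hmap : ∀ v : N.V, (span K (φ '' ↑(N.inArcs v))).map f = span K (φ '' ↑(N.inArcs v)) :=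
        fun v => by rw [hfid]; exact Submodule.map_id _
      have hsum : ∑ v ∈ Mset, finrank K ((span K (φ '' ↑(N.inArcs v))).map f) =
          ∑ v ∈ Mset, finrank K (span K (φ '' ↑(N.inArcs v))) :=
        Finset.sum_congr rfl fun v _ => by rw [hmap]
      rw [hsum]
      simp
    | succ R ih =>
      intro f' hf'
      obtain ⟨f, hf⟩ := codingVolume_exists_kill (K := K) {j | hr j < R}
      have hlev := codingVolume_linear_level hloc hdec hfar hr hrA hhr R hf hf'
      rw [← hM] at hlev
      have hprev := ih f hf
      -- split `{hr < R + 1}` into `{hr < R}` and `{hr = R}`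
      have hsplitc : (univ.filter fun i => hr i < R + 1).card =
          (univ.filter fun i => hr i < R).card + (univ.filter fun i => hr i = R).card := by
        rw [← Finset.card_union_of_disjoint]
        · congr 1; ext i; simp only [Finset.mem_filter, Finset.mem_univ, true_and,
            Finset.mem_union]; omega
        · rw [Finset.disjoint_filter]; intro i _ h; omega
      have hsplits : ∑ i ∈ univ.filter (fun i => hr i < R + 1), (N.inArcs (N.sink i)).card =
          ∑ i ∈ univ.filter (fun i => hr i < R), (N.inArcs (N.sink i)).card +
          ∑ i ∈ univ.filter (fun i => hr i = R), (N.inArcs (N.sink i)).card := by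
        rw [← Finset.sum_union]
        · congr 1; ext i; simp only [Finset.mem_filter, Finset.mem_univ, true_and,
            Finset.mem_union]; omega
        · rw [Finset.disjoint_filter]; intro i _ h; omega
      rw [hsplitc, hsplits]
      omega
  -- at `R = max + 1` everything is killed
  set R := univ.sup hr + 1 with hR
  have hall : ∀ i, hr i < R := fun i => Nat.lt_succ_of_le (Finset.le_sup (f := hr) (mem_univ i))
  obtain ⟨f, hf⟩ := codingVolume_exists_kill (K := K) {j | hr j < R}
  have hf0 : f = 0 := codingVolume_dual_hom_ext fun i => by
    rw [hf i, if_pos (show i ∈ {j | hr j < R} from hall i)]; rfl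
  have hst := step R f hf
  have hz : ∀ v : N.V, finrank K ((span K (φ '' ↑(N.inArcs v))).map f) = 0 := fun v => by
    rw [hf0, Submodule.map_zero, finrank_bot]
  simp only [hz, Finset.sum_const_zero, zero_add] at hst
  have hcard : (univ.filter fun i => hr i < R).card = Fintype.card ι := by
    rw [Finset.filter_true_of_mem (fun i _ => hall i), Finset.card_univ]
  have hsumall : ∑ i ∈ univ.filter (fun i => hr i < R), (N.inArcs (N.sink i)).card =
      ∑ i, (N.inArcs (N.sink i)).card := by
    rw [Finset.filter_true_of_mem (fun i _ => hall i)]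
  rw [hcard, hsumall] at hst
  exact hst

/-- **`4k ≤ m` for labelled (linear) `4`-far networks, over any field.** A k-pairs network whose
pairs are all at undirected distance `≥ 4` and whose arcs carry functionals on `K^ι` satisfying
LOCALITY and DECODABILITY has at least `4k` arcs (the potential bound, `finrank (span) ≤ card`, and
the partition of the arcs by their heads). [folklore] -/
theorem codingVolume_four_mul_card_le_arcCount_of_labels
    (hloc : ∀ b, φ b ∈ span K (φ '' ↑(N.inArcs (N.src b)) ∪
      (fun i => (LinearMap.proj i : Module.Dual K (ι → K))) '' {i | N.source i = N.src b}))
    (hdec : ∀ i, (LinearMap.proj i : Module.Dual K (ι → K)) ∈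
      span K (φ '' ↑(N.inArcs (N.sink i))))
    (hfar : N.Far 4) : 4 * Fintype.card ι ≤ N.arcCount := by
  classical
  have h := codingVolume_linear_potential hloc hdec hfar
  set Mset := univ.filter (fun v : N.V => (∀ j, v ≠ N.source j) ∧ ∀ j, v ≠ N.sink j) with hM
  -- `finrank (span of the in-labels) ≤ |In v|`
  have hfin : ∀ v, finrank K (span K (φ '' ↑(N.inArcs v))) ≤ (N.inArcs v).card := by
    intro v
    rw [← Finset.coe_image]
    exact (finrank_span_finset_le_card ((N.inArcs v).image φ)).trans Finset.card_image_le
  have h1 : ∑ v ∈ Mset, finrank K (span K (φ '' ↑(N.inArcs v))) ≤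
      ∑ v ∈ Mset, (N.inArcs v).card := Finset.sum_le_sum fun v _ => hfin v
  -- arcs partitioned by head
  have htot : ∑ v, (N.inArcs v).card = N.arcCount := by
    rw [KPairsNet.arcCount, ← Finset.card_univ, Finset.card_eq_sum_card_fiberwise
      (f := N.tgt) (t := Finset.univ) (fun a _ => Finset.mem_univ _)]
    rfl
  have hsinks : ∑ i, (N.inArcs (N.sink i)).card = ∑ v ∈ univ.image N.sink, (N.inArcs v).card := by
    rw [Finset.sum_image (fun i _ j _ h => N.sink.injective h)]
  have hdisj : Disjoint Mset (univ.image N.sink) := by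
    rw [Finset.disjoint_left]
    intro v hv hv'
    rw [hM, Finset.mem_filter] at hv
    obtain ⟨j, -, hj⟩ := Finset.mem_image.mp hv'
    exact hv.2.2 j hj.symm
  have h2 : ∑ v ∈ Mset, (N.inArcs v).card + ∑ v ∈ univ.image N.sink, (N.inArcs v).card ≤
      ∑ v, (N.inArcs v).card := by
    rw [← Finset.sum_union hdisj]
    exact Finset.sum_le_sum_of_subset_of_nonneg (Finset.subset_univ _) fun _ _ _ => Nat.zero_le _
  omega

end Four

section Boolean

variable {ι : Type} [Fintype ι] {N : KPairsNet ι}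

/-- **Cell `C = 4` of `CodingVolume` for `𝔽₂`-LINEAR codes (arc form).** A k-pairs network whose
pairs are all at undirected distance `≥ 4` and which carries a binary one-shot code all of whose
arc bits are additive in the input (`c.val a (x ⊕ y) = c.val a x ⊕ c.val a y` — XOR networks,
linear network codes over `GF(2)`) has at least `4k` arcs; no degree bound is used, and `L = 4` is
optimal (`CodingVolume.Negative.codingVolume_ceiling`). [folklore] -/
theorem codingVolume_four_mul_card_le_arcCount_of_linear (N : KPairsNet ι) (hfar : N.Far 4)
    (c : N.Code)
    (hlin : ∀ a (x y : ι → Bool), c.val a (fun i => xor (x i) (y i)) = xor (c.val a x) (c.val a y)) :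
    4 * Fintype.card ι ≤ N.arcCount := by
  classical
  obtain ⟨φ, -, hloc, hdec⟩ := codingVolume_exists_linearLabels c hlin
  exact codingVolume_four_mul_card_le_arcCount_of_labels hloc hdec hfar

/-- **Rung of `CodingVolume` (crux stmt-PneNP-19454): the cell `C = 4`, every `Δ`, for linear
codes, in the shape of the crux** — `∀ Δ, ∃ L (= 4), ∀ N, N.DegLE Δ → N.Far L → (N carries an
𝔽₂-linear one-shot code) → 4·k ≤ m`; the crux itself asks this for arbitrary Boolean codes
(`Nonempty N.Code`). [folklore] -/
theorem codingVolume_rung_four_linear : ∀ Δ : ℕ, ∃ L : ℕ, ∀ (ι : Type) [Fintype ι]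
    (N : KPairsNet ι), N.DegLE Δ → N.Far L →
    (∃ c : N.Code, ∀ a (x y : ι → Bool),
      c.val a (fun i => xor (x i) (y i)) = xor (c.val a x) (c.val a y)) →
    4 * Fintype.card ι ≤ N.arcCount :=
  fun _ => ⟨4, fun _ _ N _ hfar ⟨c, hlin⟩ =>
    codingVolume_four_mul_card_le_arcCount_of_linear N hfar c hlin⟩

end Boolean

end Summit.PneNP.PneNP.Theorems
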